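import Literature.NumberTheory.LFunctions.MontgomeryExplicitFormulaContour
import Literature.NumberTheory.LFunctions.MontgomeryTheoremFromExplicitFormula
import HarnessLib

/-!
# Proof of Montgomery's explicit formula and of Montgomery's pair correlation theorem

Trunk T-ANT (`Literature/NumberTheory/LFunctions`). Proofs only (no definitions, no named facts).

DISCHARGE of the named fact (P1) `Literature.NumberTheory.LFunctions.montgomery_explicit_formula`
(Montgomery 1973, Lemma; Goldston 2005, Proposition 1 (3.11)) and, with it, of
`Literature.NumberTheory.LFunctions.montgomery_pair_correlation_restricted` (Montgomery 1973,
Theorem; Goldston 2005, Theorem 1) and `Literature.NumberTheory.LFunctions.tendsto_montgomeryFormFactor`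
(rh.S31), which `MontgomeryTheoremFromExplicitFormula.lean` had reduced to (P1) alone.

The explicit formula. With `s₁ = −1/2+it`, `s₂ = 3/2+it`, `k(p) = 1/(p−s₁) − 1/(p−s₂)`,
`r(s) = x^s k(s)` (so that `r(1/2+iγ) = 2x^{1/2+iγ}/(1+(γ−t)²)`), the contour argument of
`MontgomeryExplicitFormulaContour.lean` (`two_pi_mul_zeroSum_eq_lineIntegral`) and the evaluation
of the line integral in `MontgomeryExplicitFormulaLineIntegral.lean`
(`integral_logDeriv_riemannXi_mul_kernels`) give, under RH and for `x ≥ 1`,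
`2x^{1/2} S(x,t) = x^{s₁}(Γ_ℝ'/Γ_ℝ(s₁) + Γ_ℝ'/Γ_ℝ(1−s₁) − L(Λ, 3/2−it)) + x k(1) − x^{it} A(x,t)
 − ∑_j k(−2(j+1)) x^{−2(j+1)}`, `x k(1) = 2x/((1/2+it)(3/2−it))`. Multiplying by `x^{−it}` this is
Goldston's (3.11) with
`E₁ = Γ_ℝ'/Γ_ℝ(s₁) + Γ_ℝ'/Γ_ℝ(1−s₁) − L(Λ, 3/2−it) − log(|t|+2)` and
`E₂ = −x^{−it} ∑_j k(−2(j+1)) x^{−2(j+1)}`; this file bounds the two remainders: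

* `Montgomery.exists_norm_gammaTerms_sub_log_le` — `‖E₁‖ ≤ C` (Stirling's formula for `ψ` in the
  form `|Re ψ(w) − log‖w‖| ≤ 1/(2‖w‖²) + π/(4|Im w|)`, `|Im ψ(w)| ≤ |Im w|/‖w‖² + π/2` of
  `Literature/Analysis/SpecialFunctions/DigammaGauss.lean`, `DigammaLogBound.lean`; this replaces
  Goldston's "`ζ'/ζ(−1/2+it) = −log(|t|+2) + O(1)` from the functional equation");
* `Montgomery.norm_trivialZeroSeries_le` — `‖∑_j k(−2(j+1)) x^{−2(j+1)}‖ ≤ 8x^{−2}/(|t|+2)`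
  (`|k(−2(j+1))| ≤ 2/((2j+3/2)²+t²)` and a telescoping comparison);
* `montgomery_explicit_formula_holds`, `montgomery_pair_correlation_restricted_holds`,
  `tendsto_montgomeryFormFactor_holds`.

## References

* H. L. Montgomery, *The pair correlation of zeros of the zeta function*, Analytic Number Theory
  (St. Louis 1972), Proc. Sympos. Pure Math. 24, AMS (1973), 181–193, Lemma and Theorem.
* D. A. Goldston, *Notes on pair correlation of zeros and prime numbers*, in: Recent Perspectives in
  Random Matrix Theory and Number Theory, LMS Lecture Note Ser. 322, CUP (2005), 79–110
  (arXiv:math/0412313), Proposition 1 (3.11)–(3.14), Theorem 1.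
-/

noncomputable section

open Complex Filter Set MeasureTheory
open ArithmeticFunction hiding log id
open scoped Real Topology ComplexConjugate

namespace Literature.NumberTheory.LFunctions

namespace Montgomery

open Literature.Analysis.SpecialFunctions.Complex

/-! ## The remainder `E₁`: `Γ_ℝ'/Γ_ℝ(s₁) + Γ_ℝ'/Γ_ℝ(1−s₁) − L(Λ, 3/2−it) = log(|t|+2) + O(1)` -/

/-- `‖L(Λ, 3/2 − it)‖ ≤ ∑ Λ(n) n^{−3/2}`. [folklore] -/
theorem norm_LSeries_vonMangoldt_three_halves_le (t : ℝ) :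
    ‖LSeries (fun n ↦ (Λ n : ℂ)) (3 / 2 - t * I)‖ ≤
      ∑' n : ℕ, ‖LSeries.term (fun n ↦ (Λ n : ℂ)) (3 / 2 : ℂ) n‖ := by
  have h := norm_LSeries_vonMangoldt_le (-t)
  have e : ((3 / 2 : ℝ) : ℂ) + ((-t : ℝ) : ℂ) * I = 3 / 2 - t * I := by push_cast; ring
  rwa [e] at h

/-- Stirling for `ψ` in the form needed here: for `re w > 0` and `|im w| ≥ 1`,
`‖ψ(w) − log ‖w‖‖ ≤ 5` (`abs_re_digamma_sub_log_norm_le`, `abs_im_digamma_le`). [folklore] -/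
theorem norm_digamma_sub_log_norm_le {w : ℂ} (hw : 0 < w.re) (hy : 1 ≤ |w.im|) :
    ‖digamma w - Real.log ‖w‖‖ ≤ 5 := by
  have hy0 : w.im ≠ 0 := fun h ↦ by rw [h, abs_zero] at hy; norm_num at hy
  have h1 := abs_re_digamma_sub_log_norm_le hw hy0
  have h2 := abs_im_digamma_le hw hy0
  have hw1 : 1 ≤ ‖w‖ := hy.trans (abs_im_le_norm w)
  have hw0 : 0 < ‖w‖ := by linarith
  have ha : 1 / (2 * ‖w‖ ^ 2) ≤ 1 / 2 := by
    rw [div_le_div_iff₀ (by positivity) (by norm_num)]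
    nlinarith
  have hb : π / (4 * |w.im|) ≤ 1 := by
    rw [div_le_one (by positivity)]
    linarith [Real.pi_lt_four]
  have hc : |w.im| / ‖w‖ ^ 2 ≤ 1 := by
    rw [div_le_one (by positivity)]
    nlinarith [abs_im_le_norm w]
  have hd : π / 2 ≤ 2 := by linarith [Real.pi_lt_four]
  have h3 := Complex.norm_le_abs_re_add_abs_im (digamma w - Real.log ‖w‖)
  have hre : (digamma w - Real.log ‖w‖).re = (digamma w).re - Real.log ‖w‖ := by simp
  have him : (digamma w - Real.log ‖w‖).im = (digamma w).im := by simp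
  rw [hre, him] at h3
  linarith

/-- `π^{-1}`-free form of `Γ_ℝ'/Γ_ℝ` at the two points: with `s₁ = −1/2 + it`,
`Γ_ℝ'/Γ_ℝ(s₁) + Γ_ℝ'/Γ_ℝ(1 − s₁) = −log π + (ψ(3/4 + it/2) + ψ(3/4 − it/2))/2 − (s₁/2)⁻¹/2`
(`Γ_ℝ'/Γ_ℝ(w) = −½log π + ½ψ(w/2)` and `ψ(z) = ψ(z+1) − 1/z` at `z = s₁/2`). [folklore] -/
theorem logDeriv_Gammaℝ_add_logDeriv_Gammaℝ_one_sub (t : ℝ) :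
    logDeriv Gammaℝ (-1 / 2 + t * I) + logDeriv Gammaℝ (1 - (-1 / 2 + t * I)) =
      -(Real.log π : ℂ) +
        (digamma (((3 / 4 : ℝ) : ℂ) + ((t / 2 : ℝ) : ℂ) * I) +
          digamma (((3 / 4 : ℝ) : ℂ) + ((-(t / 2) : ℝ) : ℂ) * I)) / 2 -
        ((-1 / 2 + t * I) / 2)⁻¹ / 2 := by
  set s₁ : ℂ := -1 / 2 + t * I with hs₁
  have h1 : ∀ m : ℕ, s₁ / 2 ≠ -m := by
    intro m h
    have := congrArg re h
    rw [hs₁] at this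
    simp at this
    have h4 : (4 : ℝ) * m = 1 := by linarith
    have h4' : (4 : ℕ) * m = 1 := by exact_mod_cast h4
    omega
  have h2 : ∀ m : ℕ, (1 - s₁) / 2 ≠ -m := by
    intro m h
    have := congrArg re h
    rw [hs₁] at this
    simp at this
    linarith [(m.cast_nonneg : (0 : ℝ) ≤ m)]
  have e1 : s₁ / 2 + 1 = ((3 / 4 : ℝ) : ℂ) + ((t / 2 : ℝ) : ℂ) * I := by
    rw [hs₁]; push_cast; ring
  have e2 : (1 - s₁) / 2 = ((3 / 4 : ℝ) : ℂ) + ((-(t / 2) : ℝ) : ℂ) * I := by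
    rw [hs₁]; push_cast; ring
  rw [LFunctions.logDeriv_Gammaℝ h1, LFunctions.logDeriv_Gammaℝ h2,
    ← Complex.ofReal_log Real.pi_pos.le]
  have h3 : digamma (s₁ / 2) = digamma (s₁ / 2 + 1) - (s₁ / 2)⁻¹ := by
    rw [Complex.digamma_apply_add_one (s₁ / 2) h1]; ring
  rw [h3, e1, e2]
  ring

/-- **The remainder `E₁` is bounded**: there is an absolute `C` with
`‖Γ_ℝ'/Γ_ℝ(−1/2+it) + Γ_ℝ'/Γ_ℝ(3/2−it) − L(Λ, 3/2−it) − log(|t|+2)‖ ≤ C` for all real `t`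
(Stirling's formula for `ψ`; this is the "`ζ'/ζ(−1/2+it) = −log(|t|+2) + O(1)`" of Goldston's proof,
transported to the Gamma side by the functional equation). [cite: Goldston2005, Proposition 1 (proof)] -/
theorem exists_norm_gammaTerms_sub_log_le :
    ∃ C : ℝ, ∀ t : ℝ, ‖logDeriv Gammaℝ (-1 / 2 + t * I) + logDeriv Gammaℝ (1 - (-1 / 2 + t * I)) -
        LSeries (fun n ↦ (Λ n : ℂ)) (3 / 2 - t * I) - Real.log (|t| + 2)‖ ≤ C := by
  obtain ⟨Cψ, hψ⟩ := exists_norm_digamma_vertical_le (a := 3 / 4) (by norm_num)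
  set M : ℝ := ∑' n : ℕ, ‖LSeries.term (fun n ↦ (Λ n : ℂ)) (3 / 2 : ℂ) n‖ with hM
  refine ⟨|Cψ| + M + 11, fun t ↦ ?_⟩
  have hL := norm_LSeries_vonMangoldt_three_halves_le t
  rw [logDeriv_Gammaℝ_add_logDeriv_Gammaℝ_one_sub t]
  set w₁ : ℂ := ((3 / 4 : ℝ) : ℂ) + ((t / 2 : ℝ) : ℂ) * I with hw₁
  set w₂ : ℂ := ((3 / 4 : ℝ) : ℂ) + ((-(t / 2) : ℝ) : ℂ) * I with hw₂
  set L := LSeries (fun n ↦ (Λ n : ℂ)) (3 / 2 - t * I) with hLdef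
  -- the elementary pieces
  have hπ : ‖(Real.log π : ℂ)‖ ≤ 2 := by
    rw [norm_real, Real.norm_eq_abs, abs_of_pos (Real.log_pos (by linarith [Real.pi_gt_three]))]
    exact log_pi_lt_two.le
  have hinv : ‖((-1 / 2 + t * I) / 2)⁻¹‖ ≤ 4 := by
    rw [norm_inv]
    have e : (-1 / 2 + (t : ℂ) * I) / 2 = ((-(1 / 4) : ℝ) : ℂ) + ((t / 2 : ℝ) : ℂ) * I := by
      push_cast; ring
    have h : (1 / 4 : ℝ) ≤ ‖(-1 / 2 + (t : ℂ) * I) / 2‖ := by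
      rw [e]
      have hz : (((-(1 / 4) : ℝ) : ℂ) + ((t / 2 : ℝ) : ℂ) * I).re = -(1 / 4) := by simp
      have := abs_re_le_norm (((-(1 / 4) : ℝ) : ℂ) + ((t / 2 : ℝ) : ℂ) * I)
      rwa [hz, abs_neg, abs_of_pos (by norm_num : (0 : ℝ) < 1 / 4)] at this
    calc ‖(-1 / 2 + (t : ℂ) * I) / 2‖⁻¹ ≤ (1 / 4 : ℝ)⁻¹ := by
          exact inv_anti₀ (by norm_num) h
      _ = 4 := by norm_num
  have hw₁re : w₁.re = 3 / 4 := by simp [hw₁]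
  have hw₂re : w₂.re = 3 / 4 := by simp [hw₂]
  have hw₁im : w₁.im = t / 2 := by simp [hw₁]
  have hw₂im : w₂.im = -(t / 2) := by simp [hw₂]
  have hnorm : ‖w₂‖ = ‖w₁‖ := by
    have : w₂ = conj w₁ := by
      rw [hw₁, hw₂, map_add, map_mul, conj_ofReal, conj_ofReal, conj_I]
      push_cast
      ring
    rw [this, norm_conj]
  rcases lt_or_ge |t| 2 with ht | ht
  · -- small `t`: everything is bounded
    have hψ₁ : ‖digamma w₁‖ ≤ |Cψ| + 1 := by
      have h := hψ (t / 2)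
      have hlog : Real.log (1 + |t / 2|) ≤ 1 := by
        rw [Real.log_le_iff_le_exp (by positivity)]
        have : |t / 2| < 1 := by rw [abs_div, abs_two]; linarith
        linarith [Real.add_one_le_exp (1 : ℝ)]
      calc ‖digamma w₁‖ ≤ Cψ + Real.log (1 + |t / 2|) := h
        _ ≤ |Cψ| + 1 := by linarith [le_abs_self Cψ]
    have hψ₂ : ‖digamma w₂‖ ≤ |Cψ| + 1 := by
      have h := hψ (-(t / 2))
      have hlog : Real.log (1 + |-(t / 2)|) ≤ 1 := by
        rw [Real.log_le_iff_le_exp (by positivity)]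
        have : |-(t / 2)| < 1 := by rw [abs_neg, abs_div, abs_two]; linarith
        linarith [Real.add_one_le_exp (1 : ℝ)]
      calc ‖digamma w₂‖ ≤ Cψ + Real.log (1 + |-(t / 2)|) := h
        _ ≤ |Cψ| + 1 := by linarith [le_abs_self Cψ]
    have hlog : ‖(Real.log (|t| + 2) : ℂ)‖ ≤ 2 := by
      rw [norm_real, Real.norm_eq_abs, abs_of_nonneg (Real.log_nonneg (by linarith [abs_nonneg t]))]
      rw [Real.log_le_iff_le_exp (by positivity)]
      have := Real.add_one_le_exp (1 : ℝ)
      have h2 : Real.exp 2 = Real.exp 1 * Real.exp 1 := by rw [← Real.exp_add]; norm_num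
      nlinarith [Real.exp_pos 1]
    calc ‖-(Real.log π : ℂ) + (digamma w₁ + digamma w₂) / 2 - ((-1 / 2 + t * I) / 2)⁻¹ / 2 - L -
          (Real.log (|t| + 2) : ℂ)‖
        ≤ ‖(Real.log π : ℂ)‖ + (‖digamma w₁‖ + ‖digamma w₂‖) / 2 +
            ‖((-1 / 2 + t * I) / 2)⁻¹‖ / 2 + ‖L‖ + ‖(Real.log (|t| + 2) : ℂ)‖ := by
          refine (norm_sub_le _ _).trans (add_le_add ?_ le_rfl)
          refine (norm_sub_le _ _).trans (add_le_add ?_ le_rfl)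
          refine (norm_sub_le _ _).trans (add_le_add ?_ (by rw [norm_div, Complex.norm_two]))
          refine (norm_add_le _ _).trans (add_le_add (by rw [norm_neg]) ?_)
          rw [norm_div, Complex.norm_two]
          exact div_le_div_of_nonneg_right (norm_add_le _ _) (by norm_num)
      _ ≤ 2 + ((|Cψ| + 1) + (|Cψ| + 1)) / 2 + 4 / 2 + M + 2 := by
          gcongr
      _ ≤ |Cψ| + M + 11 := by linarith [abs_nonneg Cψ]
  · -- large `t`: Stirling
    have him₁ : 1 ≤ |w₁.im| := by rw [hw₁im, abs_div, abs_two]; linarith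
    have him₂ : 1 ≤ |w₂.im| := by rw [hw₂im, abs_neg, abs_div, abs_two]; linarith
    have hψ₁ := norm_digamma_sub_log_norm_le (by rw [hw₁re]; norm_num) him₁
    have hψ₂ := norm_digamma_sub_log_norm_le (by rw [hw₂re]; norm_num) him₂
    rw [hnorm] at hψ₂
    -- `log ‖w₁‖` versus `log(|t|+2)`
    have hwlow : (|t| + 2) / 4 ≤ ‖w₁‖ := by
      have := abs_im_le_norm w₁
      rw [hw₁im, abs_div, abs_two] at this
      linarith
    have hwup : ‖w₁‖ ≤ |t| + 2 := by
      have := norm_add_le (((3 / 4 : ℝ) : ℂ)) (((t / 2 : ℝ) : ℂ) * I)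
      have e1 : ‖(((3 / 4 : ℝ) : ℂ))‖ = 3 / 4 := by
        rw [norm_real, Real.norm_eq_abs]; norm_num
      have e2 : ‖((t / 2 : ℝ) : ℂ) * I‖ = |t| / 2 := by
        rw [norm_mul, norm_I, mul_one, norm_real, Real.norm_eq_abs, abs_div, abs_two]
      rw [e1, e2] at this
      rw [hw₁]
      linarith [abs_nonneg t]
    have hw0 : 0 < ‖w₁‖ := by linarith [abs_nonneg t]
    have hlogdiff : ‖(Real.log ‖w₁‖ : ℂ) - (Real.log (|t| + 2) : ℂ)‖ ≤ 2 := by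
      rw [← ofReal_sub, norm_real, Real.norm_eq_abs, abs_le]
      constructor
      · -- `log ‖w₁‖ ≥ log(|t|+2) − log 4`
        have h := Real.log_le_log (by positivity) hwlow
        rw [Real.log_div (by positivity) (by norm_num)] at h
        have h4 : Real.log 4 ≤ 2 := by
          rw [Real.log_le_iff_le_exp (by norm_num)]
          have := Real.add_one_le_exp (1 : ℝ)
          have h2 : Real.exp 2 = Real.exp 1 * Real.exp 1 := by rw [← Real.exp_add]; norm_num
          nlinarith [Real.exp_pos 1]
        linarith
      · linarith [Real.log_le_log hw0 hwup]
    have key : -(Real.log π : ℂ) + (digamma w₁ + digamma w₂) / 2 - ((-1 / 2 + t * I) / 2)⁻¹ / 2 -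
        L - (Real.log (|t| + 2) : ℂ) =
        -(Real.log π : ℂ) + ((digamma w₁ - Real.log ‖w₁‖) + (digamma w₂ - Real.log ‖w₁‖)) / 2 +
          ((Real.log ‖w₁‖ : ℂ) - (Real.log (|t| + 2) : ℂ)) -
          ((-1 / 2 + t * I) / 2)⁻¹ / 2 - L := by ring
    rw [key]
    calc ‖-(Real.log π : ℂ) + ((digamma w₁ - Real.log ‖w₁‖) + (digamma w₂ - Real.log ‖w₁‖)) / 2 +
          ((Real.log ‖w₁‖ : ℂ) - (Real.log (|t| + 2) : ℂ)) -
          ((-1 / 2 + t * I) / 2)⁻¹ / 2 - L‖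
        ≤ ‖(Real.log π : ℂ)‖ + (‖digamma w₁ - Real.log ‖w₁‖‖ + ‖digamma w₂ - Real.log ‖w₁‖‖) / 2 +
            ‖(Real.log ‖w₁‖ : ℂ) - (Real.log (|t| + 2) : ℂ)‖ +
            ‖((-1 / 2 + t * I) / 2)⁻¹‖ / 2 + ‖L‖ := by
          refine (norm_sub_le _ _).trans (add_le_add ?_ le_rfl)
          refine (norm_sub_le _ _).trans (add_le_add ?_ (by rw [norm_div, Complex.norm_two]))
          refine (norm_add_le _ _).trans (add_le_add ?_ le_rfl)
          refine (norm_add_le _ _).trans (add_le_add (by rw [norm_neg]) ?_)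
          rw [norm_div, Complex.norm_two]
          exact div_le_div_of_nonneg_right (norm_add_le _ _) (by norm_num)
      _ ≤ 2 + (5 + 5) / 2 + 2 + 4 / 2 + M := by gcongr
      _ ≤ |Cψ| + M + 11 := by linarith [abs_nonneg Cψ]

/-! ## The remainder `E₂`: the trivial-zero series -/

/-- The pair kernel at the trivial zeros: with `s₁ = −1/2+it`, `s₂ = 3/2+it`, `p = −2(j+1)`,
`‖1/(p−s₁) − 1/(p−s₂)‖ ≤ 2/((2j+3/2)² + t²)`. [folklore] -/
theorem norm_kernel_trivialZero_le (t : ℝ) (j : ℕ) :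
    ‖1 / (-(2 * ((j : ℂ) + 1)) - (-1 / 2 + t * I)) - 1 / (-(2 * ((j : ℂ) + 1)) - (3 / 2 + t * I))‖ ≤
      2 / ((2 * (j : ℝ) + 3 / 2) ^ 2 + t ^ 2) := by
  set a : ℂ := -(2 * ((j : ℂ) + 1)) - (-1 / 2 + t * I) with ha
  set b : ℂ := -(2 * ((j : ℂ) + 1)) - (3 / 2 + t * I) with hb
  have ea : a = ((-(2 * (j : ℝ) + 3 / 2) : ℝ) : ℂ) + ((-t : ℝ) : ℂ) * I := by
    rw [ha]; push_cast; ring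
  have eb : b = ((-(2 * (j : ℝ) + 7 / 2) : ℝ) : ℂ) + ((-t : ℝ) : ℂ) * I := by
    rw [hb]; push_cast; ring
  have hna : ‖a‖ ^ 2 = (2 * (j : ℝ) + 3 / 2) ^ 2 + t ^ 2 := by
    rw [ea, Complex.sq_norm, Complex.normSq_apply]
    simp
    ring
  have hnb : ‖b‖ ^ 2 = (2 * (j : ℝ) + 7 / 2) ^ 2 + t ^ 2 := by
    rw [eb, Complex.sq_norm, Complex.normSq_apply]
    simp
    ring
  have hj : (0 : ℝ) ≤ j := j.cast_nonneg
  have hD : 0 < (2 * (j : ℝ) + 3 / 2) ^ 2 + t ^ 2 := by positivity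
  have hDb : 0 < (2 * (j : ℝ) + 7 / 2) ^ 2 + t ^ 2 := by positivity
  have ha0 : a ≠ 0 := fun h ↦ by
    rw [h, norm_zero] at hna; norm_num at hna; linarith
  have hb0 : b ≠ 0 := fun h ↦ by
    rw [h, norm_zero] at hnb; norm_num at hnb; linarith
  have hna' : ‖a‖ = Real.sqrt ((2 * (j : ℝ) + 3 / 2) ^ 2 + t ^ 2) := by
    rw [← hna, Real.sqrt_sq (norm_nonneg _)]
  have hnb' : ‖b‖ = Real.sqrt ((2 * (j : ℝ) + 7 / 2) ^ 2 + t ^ 2) := by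
    rw [← hnb, Real.sqrt_sq (norm_nonneg _)]
  have hab : (2 * (j : ℝ) + 3 / 2) ^ 2 + t ^ 2 ≤ ‖a‖ * ‖b‖ := by
    rw [hna', hnb']
    calc (2 * (j : ℝ) + 3 / 2) ^ 2 + t ^ 2
        = Real.sqrt ((2 * (j : ℝ) + 3 / 2) ^ 2 + t ^ 2) *
            Real.sqrt ((2 * (j : ℝ) + 3 / 2) ^ 2 + t ^ 2) := (Real.mul_self_sqrt hD.le).symm
      _ ≤ Real.sqrt ((2 * (j : ℝ) + 3 / 2) ^ 2 + t ^ 2) *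
            Real.sqrt ((2 * (j : ℝ) + 7 / 2) ^ 2 + t ^ 2) :=
          mul_le_mul_of_nonneg_left (Real.sqrt_le_sqrt (by nlinarith)) (Real.sqrt_nonneg _)
  have hnum : (1 : ℂ) * b - a * 1 = -2 := by rw [ha, hb]; ring
  rw [div_sub_div _ _ ha0 hb0, hnum, norm_div, norm_neg, Complex.norm_two, norm_mul]
  exact div_le_div_of_nonneg_left (by norm_num) hD hab

/-- For `x ≥ 1`: `‖x^{−2(j+1)}‖ ≤ x^{−2}`. [folklore] -/
theorem norm_cpow_trivialZero_le {x : ℝ} (hx : 1 ≤ x) (j : ℕ) :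
    ‖(x : ℂ) ^ (-(2 * ((j : ℂ) + 1)))‖ ≤ x ^ (-2 : ℝ) := by
  have hx0 : 0 < x := one_pos.trans_le hx
  rw [norm_cpow_eq_rpow_re_of_pos hx0]
  refine Real.rpow_le_rpow_of_exponent_le hx ?_
  simp

/-- The comparison series: for `j ≥ 0`, `u ≥ 0`, `a = 1 + u/2`,
`1/((2j+3/2)² + u²) ≤ (16/9)(1/(j+a) − 1/(j+a+1))`. [folklore] -/
theorem inv_trivialZero_le_telescope {j u : ℝ} (hj : 0 ≤ j) (hu : 0 ≤ u) :
    1 / ((2 * j + 3 / 2) ^ 2 + u ^ 2) ≤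
      16 / 9 * (1 / (j + (1 + u / 2)) - 1 / (j + (1 + u / 2) + 1)) := by
  have hP : 0 < (j + (1 + u / 2)) * (j + (1 + u / 2) + 1) := by positivity
  have e : 1 / (j + (1 + u / 2)) - 1 / (j + (1 + u / 2) + 1) =
      1 / ((j + (1 + u / 2)) * (j + (1 + u / 2) + 1)) := by
    field_simp
    ring
  rw [e, ← div_eq_mul_one_div, div_le_div_iff₀ (by positivity) hP]
  nlinarith [sq_nonneg (j - u / 4), sq_nonneg (u - 1), mul_nonneg hj hu, sq_nonneg j, sq_nonneg u]

/-- **The remainder `E₂`**: for `x ≥ 1` and real `t`, the trivial-zero series converges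
absolutely and `‖∑_j k(−2(j+1)) x^{−2(j+1)}‖ ≤ 8 x^{−2}/(|t|+2)` (`|k(−2(j+1))| ≤ 2/((2j+3/2)²+t²)`,
`x^{−2(j+1)} ≤ x^{−2}`, and `∑_j 1/((2j+3/2)²+t²) ≤ (32/9)/(|t|+2)` by telescoping).
[cite: Goldston2005, Proposition 1 (3.11)] -/
theorem norm_trivialZeroSeries_le {x : ℝ} (hx : 1 ≤ x) (t : ℝ) :
    ‖∑' j : ℕ, (1 / (-(2 * ((j : ℂ) + 1)) - (-1 / 2 + t * I)) -
        1 / (-(2 * ((j : ℂ) + 1)) - (3 / 2 + t * I))) * (x : ℂ) ^ (-(2 * ((j : ℂ) + 1)))‖ ≤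
      8 * (x ^ (-2 : ℝ) / (|t| + 2)) := by
  have hx0 : 0 < x := one_pos.trans_le hx
  set f : ℕ → ℂ := fun j ↦ (1 / (-(2 * ((j : ℂ) + 1)) - (-1 / 2 + t * I)) -
    1 / (-(2 * ((j : ℂ) + 1)) - (3 / 2 + t * I))) * (x : ℂ) ^ (-(2 * ((j : ℂ) + 1))) with hf
  set a : ℝ := 1 + |t| / 2 with ha
  set B : ℝ := 2 * x ^ (-2 : ℝ) * (16 / 9) with hB
  have ha0 : 0 < a := by positivity
  have hB0 : 0 ≤ B := by positivity
  -- termwise bound by a telescoping sequence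
  have hterm : ∀ j : ℕ, ‖f j‖ ≤ B * (1 / (j + a) - 1 / (j + a + 1)) := by
    intro j
    have hj : (0 : ℝ) ≤ j := j.cast_nonneg
    rw [hf]
    simp only [norm_mul]
    have h1 := norm_kernel_trivialZero_le t j
    have h2 := norm_cpow_trivialZero_le hx j
    have h3 := inv_trivialZero_le_telescope hj (abs_nonneg t)
    rw [sq_abs] at h3
    calc ‖1 / (-(2 * ((j : ℂ) + 1)) - (-1 / 2 + t * I)) - 1 / (-(2 * ((j : ℂ) + 1)) - (3 / 2 + t * I))‖ *
          ‖(x : ℂ) ^ (-(2 * ((j : ℂ) + 1)))‖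
        ≤ 2 / ((2 * (j : ℝ) + 3 / 2) ^ 2 + t ^ 2) * x ^ (-2 : ℝ) :=
          mul_le_mul h1 h2 (norm_nonneg _) (by positivity)
      _ = 2 * x ^ (-2 : ℝ) * (1 / ((2 * (j : ℝ) + 3 / 2) ^ 2 + t ^ 2)) := by ring
      _ ≤ 2 * x ^ (-2 : ℝ) * (16 / 9 * (1 / (j + (1 + |t| / 2)) - 1 / (j + (1 + |t| / 2) + 1))) :=
          mul_le_mul_of_nonneg_left h3 (by positivity)
      _ = B * (1 / (j + a) - 1 / (j + a + 1)) := by rw [hB, ha]; ring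
  -- partial sums
  have hpartial : ∀ N : ℕ, ∑ j ∈ Finset.range N, ‖f j‖ ≤ B * (1 / a - 1 / (N + a)) := by
    intro N
    induction N with
    | zero => simp
    | succ N ih =>
      rw [Finset.sum_range_succ]
      have h := hterm N
      have e : (((N + 1 : ℕ) : ℝ) + a) = (N : ℝ) + a + 1 := by push_cast; ring
      rw [e]
      nlinarith
  have hbound : ∀ N : ℕ, ∑ j ∈ Finset.range N, ‖f j‖ ≤ B / a := by
    intro N
    refine (hpartial N).trans ?_
    have : 0 ≤ 1 / ((N : ℝ) + a) := by positivity
    calc B * (1 / a - 1 / (N + a)) ≤ B * (1 / a) := by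
          exact mul_le_mul_of_nonneg_left (by linarith) hB0
      _ = B / a := by ring
  have hsum : Summable fun j ↦ ‖f j‖ := summable_of_sum_range_le (fun _ ↦ norm_nonneg _) hbound
  calc ‖∑' j, f j‖ ≤ ∑' j, ‖f j‖ := norm_tsum_le_tsum_norm hsum
    _ ≤ B / a := Real.tsum_le_of_sum_range_le (fun _ ↦ norm_nonneg _) hbound
    _ = 64 / 9 * (x ^ (-2 : ℝ) / (|t| + 2)) := by
        rw [hB, ha]
        field_simp
        ring
    _ ≤ 8 * (x ^ (-2 : ℝ) / (|t| + 2)) := by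
        gcongr
        norm_num

end Montgomery

/-! ## The explicit formula -/

open Montgomery in
/-- **DISCHARGE of (P1) `Literature.NumberTheory.LFunctions.montgomery_explicit_formula` —
Montgomery's explicit formula** (Montgomery 1973, Lemma; Goldston 2005, Proposition 1 (3.11)):
assuming RH, for `x ≥ 1` and real `t`,
`2x^{1/2−it} ∑_γ x^{iγ}/(1+(t−γ)²) = −∑ Λ(n)a_n(x)n^{−it} + 2x^{1−it}/((1/2+it)(3/2−it))`
`  + x^{−1/2}(log(|t|+2) + E₁) + E₂`, `‖E₁‖ ≤ C`, `‖E₂‖ ≤ C x^{−2}/(|t|+2)`.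
Proof: `two_pi_mul_zeroSum_eq_lineIntegral` (the contour argument) and
`integral_logDeriv_riemannXi_mul_kernels` (the evaluation of the line integral) give
`2x^{1/2} S = x^{s₁}(Γ_ℝ'/Γ_ℝ(s₁) + Γ_ℝ'/Γ_ℝ(1−s₁) − L(Λ,3/2−it)) + x k(1) − x^{it}A − ∑_j k(−2(j+1))x^{−2(j+1)}`;
multiply by `x^{−it}` and put `E₁ := Γ_ℝ'/Γ_ℝ(s₁) + Γ_ℝ'/Γ_ℝ(1−s₁) − L(Λ,3/2−it) − log(|t|+2)`
(bounded, `exists_norm_gammaTerms_sub_log_le`) and `E₂ := −x^{−it} ∑_j k(−2(j+1))x^{−2(j+1)}`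
(`norm_trivialZeroSeries_le`). [cite: Goldston2005, Proposition 1 (3.11)] -/
theorem montgomery_explicit_formula_holds : montgomery_explicit_formula := by
  intro hRH
  obtain ⟨C₁, hC₁⟩ := exists_norm_gammaTerms_sub_log_le
  refine ⟨max C₁ 8, fun x hx t ↦ ?_⟩
  have hx0 : 0 < x := one_pos.trans_le hx
  have hx0' : (x : ℂ) ≠ 0 := ofReal_ne_zero.2 hx0.ne'
  have hB := two_pi_mul_zeroSum_eq_lineIntegral hRH hx t
  have hA := integral_logDeriv_riemannXi_mul_kernels hx t (c := 5 / 4) (by norm_num) (by norm_num)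
  rw [hA] at hB
  have h2π : (2 * π : ℂ) ≠ 0 := by simp [Real.pi_ne_zero]
  have key := mul_left_cancel₀ h2π hB
  -- abbreviations
  set G : ℂ := logDeriv Gammaℝ (-1 / 2 + t * I) + logDeriv Gammaℝ (1 - (-1 / 2 + t * I)) with hG
  set L : ℂ := LSeries (fun n ↦ (Λ n : ℂ)) (3 / 2 - t * I) with hL
  set R : ℂ := ∑' j : ℕ, (1 / (-(2 * ((j : ℂ) + 1)) - (-1 / 2 + t * I)) -
    1 / (-(2 * ((j : ℂ) + 1)) - (3 / 2 + t * I))) * (x : ℂ) ^ (-(2 * ((j : ℂ) + 1))) with hR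
  set u : ℂ := (x : ℂ) ^ (-((t : ℂ) * I)) with hu
  refine ⟨G - L - Real.log (|t| + 2), -(u * R), ?_, ?_, ?_⟩
  · -- `E₁`
    have h := hC₁ t
    have e : G - L - Real.log (|t| + 2) = logDeriv Gammaℝ (-1 / 2 + t * I) +
        logDeriv Gammaℝ (1 - (-1 / 2 + t * I)) - LSeries (fun n ↦ (Λ n : ℂ)) (3 / 2 - t * I) -
          Real.log (|t| + 2) := by rw [hG, hL]
    rw [e]
    exact h.trans (le_max_left _ _)
  · -- `E₂`
    have hu1 : ‖u‖ = 1 := by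
      rw [hu, norm_cpow_eq_rpow_re_of_pos hx0]
      simp
    rw [norm_neg, norm_mul, hu1, one_mul]
    calc ‖R‖ ≤ 8 * (x ^ (-2 : ℝ) / (|t| + 2)) := norm_trivialZeroSeries_le hx t
      _ ≤ max C₁ 8 * (x ^ (-2 : ℝ) / (|t| + 2)) :=
          mul_le_mul_of_nonneg_right (le_max_right _ _) (by positivity)
  · -- the identity
    have e1 : (x : ℂ) ^ ((1 / 2 : ℂ) - t * I) = (x : ℂ) ^ (1 / 2 : ℂ) * u := by
      rw [hu, sub_eq_add_neg, cpow_add _ _ hx0']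
    have e2 : (x : ℂ) ^ (-1 / 2 + t * I) * u = (x : ℂ) ^ (-(1 / 2 : ℂ)) := by
      rw [hu, ← cpow_add _ _ hx0']
      congr 1
      ring
    have e3 : (x : ℂ) * u = (x : ℂ) ^ ((1 : ℂ) - t * I) := by
      rw [hu]
      calc (x : ℂ) * (x : ℂ) ^ (-((t : ℂ) * I)) = (x : ℂ) ^ (1 : ℂ) * (x : ℂ) ^ (-((t : ℂ) * I)) := by
            rw [cpow_one]
        _ = (x : ℂ) ^ ((1 : ℂ) - t * I) := by
            rw [← cpow_add _ _ hx0', ← sub_eq_add_neg]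
    have e4 : (x : ℂ) ^ ((t : ℂ) * I) * u = 1 := by
      rw [hu, ← cpow_add _ _ hx0', add_neg_cancel, cpow_zero]
    have h12 : (1 / 2 + (t : ℂ) * I) ≠ 0 := by
      intro h; have := congrArg re h; norm_num at this
    have h32 : (3 / 2 - (t : ℂ) * I) ≠ 0 := by
      intro h; have := congrArg re h; norm_num at this
    have ek : (1 / (1 - (-1 / 2 + (t : ℂ) * I)) - 1 / (1 - (3 / 2 + (t : ℂ) * I))) =
        2 / ((1 / 2 + t * I) * (3 / 2 - t * I)) := by
      have ea : (1 - (-1 / 2 + (t : ℂ) * I)) = 3 / 2 - t * I := by ring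
      have eb : (1 - (3 / 2 + (t : ℂ) * I)) = -(1 / 2 + t * I) := by ring
      rw [ea, eb, one_div_neg_eq_neg_one_div, sub_neg_eq_add, div_add_div _ _ h32 h12,
        div_eq_div_iff (mul_ne_zero h32 h12) (mul_ne_zero h12 h32)]
      ring
    calc 2 * (x : ℂ) ^ ((1 / 2 : ℂ) - t * I) * montgomeryZeroSum x t
        = u * (2 * (x : ℂ) ^ (1 / 2 : ℂ) * montgomeryZeroSum x t) := by rw [e1]; ring
      _ = u * ((x : ℂ) ^ (-1 / 2 + t * I) * (G - L) +
            x * (1 / (1 - (-1 / 2 + t * I)) - 1 / (1 - (3 / 2 + t * I))) -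
            (x : ℂ) ^ ((t : ℂ) * I) * montgomeryDirichletSum x t - R) := by rw [key]
      _ = ((x : ℂ) ^ (-1 / 2 + t * I) * u) * (G - L) +
            ((x : ℂ) * u) * (1 / (1 - (-1 / 2 + t * I)) - 1 / (1 - (3 / 2 + t * I))) -
            ((x : ℂ) ^ ((t : ℂ) * I) * u) * montgomeryDirichletSum x t - u * R := by ring
      _ = (x : ℂ) ^ (-(1 / 2 : ℂ)) * (G - L) +
            (x : ℂ) ^ ((1 : ℂ) - t * I) * (2 / ((1 / 2 + t * I) * (3 / 2 - t * I))) -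
            montgomeryDirichletSum x t - u * R := by rw [e2, e3, e4, ek, one_mul]
      _ = -montgomeryDirichletSum x t +
              2 * (x : ℂ) ^ ((1 : ℂ) - t * I) / ((1 / 2 + t * I) * (3 / 2 - t * I)) +
            (x : ℂ) ^ (-(1 / 2 : ℂ)) * (Real.log (|t| + 2) + (G - L - Real.log (|t| + 2))) +
            -(u * R) := by ring

/-! ## Montgomery's theorem -/

/-- **DISCHARGE of `Literature.NumberTheory.LFunctions.montgomery_pair_correlation_restricted` —
Montgomery's pair correlation theorem** (Montgomery 1973, Theorem, uniform clause; Goldston 2005,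
Theorem 1): assuming RH, for fixed `0 < δ`, uniformly for `|α| ≤ 1 − δ`,
`F(α) = (1 + o(1)) T^{−2|α|} log T + |α| + o(1)` as `T → ∞`. Now unconditional on any named fact:
the explicit formula (P1) is `montgomery_explicit_formula_holds`, and the reduction of the theorem
to (P1) is `montgomery_pair_correlation_restricted_of_explicit_formula`
(`MontgomeryTheoremFromExplicitFormula.lean`, with (P2) `montgomery_pairSum_eq_meanSquare_holds`
and a proved substitute for the mean value theorem (P3)). [cite: Montgomery1973, Theorem] -/
theorem montgomery_pair_correlation_restricted_holds : montgomery_pair_correlation_restricted :=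
  montgomery_pair_correlation_restricted_of_explicit_formula montgomery_explicit_formula_holds

/-- **DISCHARGE of `Literature.NumberTheory.LFunctions.tendsto_montgomeryFormFactor`** (rh.S31,
Montgomery 1973, Theorem, fixed `α`): assuming RH, `F(α, T) → |α|` for `0 < |α| < 1` and
`F(0, T) − log T → 0`. [cite: Montgomery1973, Theorem] -/
theorem tendsto_montgomeryFormFactor_holds : tendsto_montgomeryFormFactor :=
  tendsto_montgomeryFormFactor_of_explicit_formula montgomery_explicit_formula_holds

end Literature.NumberTheory.LFunctions
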